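import Literature.Geometry.ComplexAnalytic.OrdinaryDoublePointLocalisation
import HarnessLib

/-!
# Sign-diagonal symmetries of the quadric act on the middle homology by the determinant; the symmetry acts by that sign on
# the localised monodromy (the local model of Wall's theorem / AGZV II §5.1 for a Morse point and an involution)

Family `hodge`, layer `Literature/Geometry/ComplexAnalytic`; proof file (theorems only, no definition, no named fact). Written
by the prover seat `hodge-nonav-prover-Bx` (g13, cell `hodge-nonav`) for crux K1-B `VeryGeneralSignCommutatorsInHg` of the route
`HodgeConjecture/SignSymmetricPowers` (stmt-HodgeConjecture-19716): the equivariant clause of `HodgeTheory.picardLefschetz_nodalForms_equivariant`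
at a node FIXED by a diagonal involution (`σ'^* δ = sgn · δ`, `sgn` the determinant of the tangent action; AGZV II §5.1 Thm. 5.1
(Wall) with Cor. of Thm. 5.2: "`[H](g) = (−1)^{n − d_g} μ_g`", the `ℤ₂`-example p. 124), reduced to its LOCAL MODEL plus an
equivariant localisation datum. Sequel of `OrdinaryDoublePointLocalisation` (antipodal map acts by `(−1)^{n+2}`).

## Contents (all PROVED)

* `map_negSingle_fibre_two`, `map_negCoords_fibre_two` — on the affine quadric `F = {Σ_{i<n+2} zᵢ² = 1}` a map changing the
  signs of the coordinates in a finite set `S` acts on `H_{n+1}(F; 𝔽)` (`𝔽` a field of characteristic zero) by `(−1)^{|S|}` —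
  the determinant of the diagonal matrix (one sign change is conjugate, by a plane rotation, to the rotation of the last coordinate
  by `−1`, killed by `1 + τ`; two sign changes are a plane rotation, homotopic to the identity).
* `map_eq_smul_on_range_of_equivariant` — **the symmetry acts by that sign on the localised monodromy**: if `Y = A ∪ B`, `h` is
  the identity on `B` with `h(A) ⊆ A`, `σ : Y → Y` preserves `A` and COMMUTES with `h`, and the chart `e : A → F` (injective on
  `H_{n+1}`) intertwines `σ|_A` with a map of `F` acting by the scalar `ε` on `H_{n+1}(F)` up to homotopy, then
  `σ^* v = ε v` for every `v ∈ (h^* − 1) H^{n+1}(Y; 𝔽)` (Kronecker duality: `(h_* − 1) H_{n+1}(Y)` lies in the image of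
  `H_{n+1}(A)`, on which `σ_*` is `ε`).

What is NOT here: the equivariant geometric datum itself (an equivariant Morse chart and isotopy of the pencil near a node fixed
by the symmetry), and symmetries that are not sign-diagonal in Morse coordinates.

## References

* [ArnoldGuseinzadeVarchenko2012] Arnold, Gusein-Zade, Varchenko, Singularities of Differentiable Maps II, Part I §5.1 Thm. 5.1,
  Thm. 5.2 and Corollary, Example (`ℤ₂`) (held text p0122–p0124); §1.1 (variation operator).
* [Milnor1968] J. Milnor, Singular Points of Complex Hypersurfaces, §9 Thm. 9.1, Lemma 9.4.
* [HatcherAT2002] A. Hatcher, Algebraic Topology, §3.1 (Kronecker pairing), §2.1 Thm. 2.20.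
-/

noncomputable section

open ContinuousMap Set CategoryTheory
open Literature.AlgebraicTopology.SingularHomology

namespace Literature.Geometry.ComplexAnalytic

namespace PhamBrieskorn

/-! ### §1 Sign changes of coordinates on the quadric act by the determinant -/

section Quadric

variable {n : ℕ} (𝔽 : Type) [Field 𝔽] [CharZero 𝔽]

/-- All exponents of the quadric are non-zero. [folklore] -/
private theorem two_ne_zero_exponents' (i : Fin (n + 2)) : (fun _ : Fin (n + 2) ↦ (2 : ℕ)) i ≠ 0 := by
  simp

/-- **One sign change acts by `−1`** on `H_{n+1}` of the quadric `Σ zᵢ² = 1`: the sign change of the last coordinate is the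
rotation by the primitive square root of unity `−1` (killed by `1 + τ`, `sum_pow_map_rotateFibre_eq_zero`); the sign change of
another coordinate `i` differs from it by the sign change of the pair `(i, last)`, a plane rotation homotopic to the identity.
[cite: ArnoldGuseinzadeVarchenko2012, Part I §5.1 Example (held text p0124)] [cite: Milnor1968, §9 Lemma 9.4] -/
theorem map_negSingle_fibre_two (i : Fin (n + 2))
    (g : C(fibre (fun _ : Fin (n + 2) ↦ (2 : ℕ)), fibre (fun _ : Fin (n + 2) ↦ (2 : ℕ))))
    (hg : ∀ z j, ((g z : fibre _) : Fin (n + 2) → ℂ) j =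
      if j = i then -(z : Fin (n + 2) → ℂ) j else (z : Fin (n + 2) → ℂ) j)
    (x : singularHomology 𝔽 𝔽 (fibre (fun _ : Fin (n + 2) ↦ (2 : ℕ))) (n + 1)) :
    (singularHomology.map 𝔽 𝔽 g (n + 1)).hom x = -x := by
  have hζ : IsPrimitiveRoot (-1 : ℂ) ((fun _ : Fin (n + 2) ↦ (2 : ℕ)) (Fin.last (n + 1))) := by
    simpa using IsPrimitiveRoot.neg_one 0 (by norm_num)
  let ρ : C(fibre (fun _ : Fin (n + 2) ↦ (2 : ℕ)), fibre (fun _ : Fin (n + 2) ↦ (2 : ℕ))) :=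
    (rotateFibre (fun _ : Fin (n + 2) ↦ (2 : ℕ)) two_ne_zero_exponents' ⟨-1, hζ.pow_eq_one⟩ :
      C(fibre (fun _ : Fin (n + 2) ↦ (2 : ℕ)), fibre (fun _ : Fin (n + 2) ↦ (2 : ℕ))))
  have hρ : ∀ z j, ((ρ z : fibre _) : Fin (n + 2) → ℂ) j =
      if j = Fin.last (n + 1) then -(z : Fin (n + 2) → ℂ) j else (z : Fin (n + 2) → ℂ) j := by
    intro z j
    change rotateFun (-1) (z : Fin (n + 2) → ℂ) j = _
    refine Fin.lastCases ?_ (fun k ↦ ?_) j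
    · rw [rotateFun_last]; simp
    · rw [rotateFun_castSucc]; simp [Fin.castSucc_ne_last]
  -- `g ≃ ρ`
  have hgρ : g.Homotopic ρ := by
    by_cases hi : i = Fin.last (n + 1)
    · subst hi
      have : g = ρ := by ext z j; rw [hg, hρ]
      rw [this]
    · -- `g = negPair(i, last) ∘ ρ`
      have hcomp : g = (negPairFibre (fun _ : Fin (n + 2) ↦ (2 : ℕ)) hi rfl rfl :
          C(fibre (fun _ : Fin (n + 2) ↦ (2 : ℕ)), fibre (fun _ : Fin (n + 2) ↦ (2 : ℕ)))).comp ρ := by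
        ext z j
        rw [hg, ContinuousMap.comp_apply]
        change _ = (fun k : Fin (n + 2) ↦ if k = i ∨ k = Fin.last (n + 1) then -((ρ z : fibre _) : Fin (n + 2) → ℂ) k
          else ((ρ z : fibre _) : Fin (n + 2) → ℂ) k) j
        simp only [hρ]
        by_cases h1 : j = i
        · subst h1; simp [hi]
        · by_cases h2 : j = Fin.last (n + 1)
          · subst h2; simp [h1]
          · simp [h1, h2]
      rw [hcomp]
      simpa using (negPairFibre_homotopic_id (fun _ : Fin (n + 2) ↦ (2 : ℕ)) hi rfl rfl).symm.comp
        (ContinuousMap.Homotopic.refl ρ)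
  rw [singularHomology.map_eq_of_homotopic 𝔽 𝔽 hgρ]
  have hsum := sum_pow_map_rotateFibre_eq_zero 𝔽 two_ne_zero_exponents' hζ x
  simp only [Finset.sum_range_succ, Finset.sum_range_zero, zero_add, pow_zero, pow_one, Module.End.one_apply] at hsum
  exact eq_neg_of_add_eq_zero_right hsum

/-- **Sign changes of the coordinates in a finite set `S` act on `H_{n+1}` of the quadric by `(−1)^{|S|}`** — the determinant
of the diagonal `±1` matrix (induction on `S`: `g_{insert i S} = neg_i ∘ g_S`). For `S = univ` this is the antipodal map
(`map_antipodal_fibre_two`). [cite: ArnoldGuseinzadeVarchenko2012, Part I §5.1 Thm. 5.1 and Example (held text p0122–p0124)] -/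
theorem map_negCoords_fibre_two (S : Finset (Fin (n + 2)))
    (g : C(fibre (fun _ : Fin (n + 2) ↦ (2 : ℕ)), fibre (fun _ : Fin (n + 2) ↦ (2 : ℕ))))
    (hg : ∀ z j, ((g z : fibre _) : Fin (n + 2) → ℂ) j =
      if j ∈ S then -(z : Fin (n + 2) → ℂ) j else (z : Fin (n + 2) → ℂ) j)
    (x : singularHomology 𝔽 𝔽 (fibre (fun _ : Fin (n + 2) ↦ (2 : ℕ))) (n + 1)) :
    (singularHomology.map 𝔽 𝔽 g (n + 1)).hom x = ((-1 : 𝔽) ^ S.card) • x := by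
  classical
  induction S using Finset.induction_on generalizing g x with
  | empty =>
    have : g = ContinuousMap.id _ := by ext z j; rw [hg]; simp
    rw [this, singularHomology.map_id, Finset.card_empty, pow_zero, one_smul]; rfl
  | insert i S hiS ih =>
    -- `g = neg_i ∘ g_S`
    let gS : C(fibre (fun _ : Fin (n + 2) ↦ (2 : ℕ)), fibre (fun _ : Fin (n + 2) ↦ (2 : ℕ))) :=
      ⟨fun z ↦ ⟨fun j ↦ if j ∈ S then -(z : Fin (n + 2) → ℂ) j else (z : Fin (n + 2) → ℂ) j,
          neg_ite_mem_fibre_two (fun j : Fin (n + 2) ↦ j ∈ S) z.2⟩,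
        Continuous.subtype_mk (continuous_pi fun j ↦ by
          split_ifs
          · exact ((continuous_apply j).comp continuous_subtype_val).neg
          · exact (continuous_apply j).comp continuous_subtype_val) _⟩
    let gi : C(fibre (fun _ : Fin (n + 2) ↦ (2 : ℕ)), fibre (fun _ : Fin (n + 2) ↦ (2 : ℕ))) :=
      ⟨fun z ↦ ⟨fun j ↦ if j = i then -(z : Fin (n + 2) → ℂ) j else (z : Fin (n + 2) → ℂ) j,
          neg_ite_mem_fibre_two (fun j : Fin (n + 2) ↦ j = i) z.2⟩,
        Continuous.subtype_mk (continuous_pi fun j ↦ by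
          split_ifs
          · exact ((continuous_apply j).comp continuous_subtype_val).neg
          · exact (continuous_apply j).comp continuous_subtype_val) _⟩
    have hcomp : g = gi.comp gS := by
      ext z j
      rw [hg, ContinuousMap.comp_apply]
      change _ = (fun k : Fin (n + 2) ↦ if k = i then -((gS z : fibre _) : Fin (n + 2) → ℂ) k
        else ((gS z : fibre _) : Fin (n + 2) → ℂ) k) j
      simp only [gS, ContinuousMap.coe_mk, Finset.mem_insert]
      by_cases h1 : j = i
      · subst h1; simp [hiS]
      · by_cases h2 : j ∈ S
        · simp [h1, h2]
        · simp [h1, h2]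
    rw [hcomp, singularHomology.map_comp, ModuleCat.comp_apply]
    change (singularHomology.map 𝔽 𝔽 gi (n + 1)).hom ((singularHomology.map 𝔽 𝔽 gS (n + 1)).hom x) = _
    rw [ih gS (fun _ _ ↦ rfl) x, map_smul, map_negSingle_fibre_two 𝔽 i gi (fun _ _ ↦ rfl),
      Finset.card_insert_of_notMem hiS, pow_succ, mul_comm, ← smul_smul, neg_one_smul, smul_neg]

end Quadric

/-! ### §2 The symmetry acts by the local sign on the localised monodromy -/

section Equivariant

variable (𝔽 : Type) [Field 𝔽] {Y : Type} [TopologicalSpace Y] {F : Type} [TopologicalSpace F]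

/-- **An equivariant localisation datum transfers the local sign to the localised monodromy** (the interface form of
AGZV II §5.1 for a Morse point). Let `Y = A ∪ B` (open), `h : Y → Y` the identity on `B` with `h(A) ⊆ A`; let `σ : Y → Y`
preserve `A` (restriction `σ_A`) and COMMUTE with `h`; let `e : A → F` be injective on `H_m(·; 𝔽)` (`H_m(F)` finite-
dimensional) with `e ∘ σ_A ≃ D ∘ e` for a map `D` of `F` acting on `H_m(F)` by the scalar `ε`. Then `σ^*` acts by `ε` on
`(h^* − 1) H^m(Y; 𝔽)`: `σ^* (h^* x − x) = ε (h^* x − x)`. Proof: `(h_* − 1) H_m(Y)` lies in the image of `H_m(A)`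
(`map_sub_self_mem_range_of_eqOn`), on which `σ_*` is `ε` (`e_* σ_{A*} = D_* e_* = ε e_*`, `e_*` injective), and `σ_*` commutes
with `h_* − 1`; dualise with the Kronecker pairing (bijective over a field).
[cite: ArnoldGuseinzadeVarchenko2012, Part I §5.1 Thm. 5.1 and §1.1 (held text p0122, p0013)] [cite: HatcherAT2002, §3.1 and §2.1 Thm. 2.20] -/
theorem map_eq_smul_on_range_of_equivariant (m : ℕ) (ε : 𝔽)
    {A B : Set Y} (hAo : IsOpen A) (hBo : IsOpen B) (hAB : A ∪ B = univ)
    (h : C(Y, Y)) (hB : ∀ y ∈ B, h y = y) (hA : Set.MapsTo h A A)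
    (σ : C(Y, Y)) (σA : C(↥A, ↥A)) (hσA : ∀ a : ↥A, ((σA a : ↥A) : Y) = σ a) (hcomm : h.comp σ = σ.comp h)
    (e : C(↥A, F)) (hinj : Function.Injective (singularHomology.map 𝔽 𝔽 e m).hom)
    (D : C(F, F)) (hD : ∀ y : singularHomology 𝔽 𝔽 F m, (singularHomology.map 𝔽 𝔽 D m).hom y = ε • y)
    (hconj : (e.comp σA).Homotopic (D.comp e))
    (x : singularCohomology 𝔽 𝔽 Y m) :
    (singularCohomology.map 𝔽 𝔽 σ m).hom
        ((singularCohomology.map 𝔽 𝔽 h m).hom x - x) =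
      ε • ((singularCohomology.map 𝔽 𝔽 h m).hom x - x) := by
  -- homology: `σ_{A*}` is `ε` on `H_m(A)`
  have hσA' : ∀ a : singularHomology 𝔽 𝔽 (↥A) m, (singularHomology.map 𝔽 𝔽 σA m).hom a = ε • a := by
    intro a
    apply hinj
    change (singularHomology.map 𝔽 𝔽 σA m ≫ singularHomology.map 𝔽 𝔽 e m) a = _
    rw [← singularHomology.map_comp, singularHomology.map_eq_of_homotopic 𝔽 𝔽 hconj, singularHomology.map_comp,
      ModuleCat.comp_apply, map_smul]
    exact hD _
  -- hence `σ_*` is `ε` on the image of `H_m(A) → H_m(Y)`, which contains `(h_* − 1) H_m(Y)`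
  have hincl : σ.comp (subsetIncl A) = (subsetIncl A).comp σA := by
    ext a
    exact (hσA a).symm
  have hσim : ∀ z : singularHomology 𝔽 𝔽 Y m,
      (singularHomology.map 𝔽 𝔽 σ m).hom ((singularHomology.map 𝔽 𝔽 h m).hom z - z) =
        ε • ((singularHomology.map 𝔽 𝔽 h m).hom z - z) := by
    intro z
    obtain ⟨a, ha⟩ := singularHomology.map_sub_self_mem_range_of_eqOn 𝔽 𝔽 hAo hBo hAB h hB hA m z
    rw [← ha]
    change (singularHomology.map 𝔽 𝔽 (subsetIncl A) m ≫ singularHomology.map 𝔽 𝔽 σ m) a =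
      ε • (singularHomology.map 𝔽 𝔽 (subsetIncl A) m).hom a
    rw [← singularHomology.map_comp, hincl, singularHomology.map_comp, ModuleCat.comp_apply]
    change (singularHomology.map 𝔽 𝔽 (subsetIncl A) m).hom ((singularHomology.map 𝔽 𝔽 σA m).hom a) = _
    rw [hσA' a, map_smul]
  -- `σ_*` commutes with `h_*`
  have hcommH : ∀ z : singularHomology 𝔽 𝔽 Y m,
      (singularHomology.map 𝔽 𝔽 h m).hom ((singularHomology.map 𝔽 𝔽 σ m).hom z) =
        (singularHomology.map 𝔽 𝔽 σ m).hom ((singularHomology.map 𝔽 𝔽 h m).hom z) := by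
    intro z
    change (singularHomology.map 𝔽 𝔽 σ m ≫ singularHomology.map 𝔽 𝔽 h m) z =
      (singularHomology.map 𝔽 𝔽 h m ≫ singularHomology.map 𝔽 𝔽 σ m) z
    rw [← singularHomology.map_comp, ← singularHomology.map_comp, ← hcomm]
  -- `(h_* − 1)(σ_* z) = ε (h_* − 1) z`
  have e1 : ∀ z : singularHomology 𝔽 𝔽 Y m,
      (singularHomology.map 𝔽 𝔽 h m).hom ((singularHomology.map 𝔽 𝔽 σ m).hom z) -
        (singularHomology.map 𝔽 𝔽 σ m).hom z = ε • ((singularHomology.map 𝔽 𝔽 h m).hom z - z) := fun z ↦ by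
    rw [hcommH, ← map_sub, hσim]
  -- dualise with the Kronecker pairing (injective over a field)
  apply kroneckerPairing_injective_of_field 𝔽 Y m
  refine LinearMap.ext fun z ↦ ?_
  simp only [map_smul, map_sub, LinearMap.smul_apply, LinearMap.sub_apply, kroneckerPairing_map]
  rw [← map_sub, ← map_sub, e1 z, map_smul]

end Equivariant

end PhamBrieskorn

end Literature.Geometry.ComplexAnalytic

end
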